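import Summits.BirchSwinnertonDyer.BirchSwinnertonDyer.Theorems.ByReductionTypeAtTwoSupersingularFlatBlindTamagawaSplittingCore
import Summits.BirchSwinnertonDyer.BirchSwinnertonDyer.Theorems.ByReductionTypeAtTwoSupersingularFlatBlindCardTransport
import Summits.BirchSwinnertonDyer.BirchSwinnertonDyer.Theorems.ByReductionTypeAtTwoSupersingularFlatBlindTwistCurveSide
import HarnessLib

/-!
# HT-C6 = h8 = B2: THE TAMAGAWA SPLITTING COUNT at a large finite level for the transported exact structure, modulo the print binder
# `hPT` — CORRECTED SIGNATURE (crux `SupersingularRankZeroAtTwo` = stmt-BirchSwinnertonDyer-19097, line `odd_blind_package` v2.10.1, slot 5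
# CDC_H, glue ★★ p814705 `OddBlindLocal.flatBlindControlCardHondaAtTwo_of` binder hB2; cell `bsd-2adic`, seat `bsd-2adic-t42` GEN 41, file 5/5)

THEOREM ONLY (no definition, no named fact, no instance, no `sorry`); `--supports stmt-BirchSwinnertonDyer-19097 --as helper`; closes
nothing; 19097 stays OPEN; CDC_H is NOT claimed; typed ≠ proved; BSD is proved for no curve by any of this.

`HTC6_tamagawa_of_lineCard (hPT) : <hB2 with ONE inner hypothesis>` — the LEAD's hand h8 (`HOME/ss/gen21/HANDTARGETS_CDC3_GEN21.lean` :72–121 =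
tree `…FlatBlindCardGlue.lean` :103–151) with `(hPT : poitouTate_selmerStructure_duality_real ℚ)` prepended (director-bsd (764)(A)(i)) and
ONE inner hypothesis inserted after `κ.IsTopGenerator (resGalOfEmb …) g →`: the ♭-LINE LOWER BOUND
`∃ J₃, ∀ J ≥ J₃, 2^J ≤ #L^E_J` at `v` (conjunct (C) of the LEAD's hand hE, tree `…FlatBlindCardPositionLocal.lean` :136–139, sub-term verbatim).
WHY THE INSERTION (`stub-misstated`, STATUS 2026-08-31): hB2 quantifies over ALL local data `c : ℕ → E(ℚ̄_v)`; for degenerate `c` (e.g.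
`c = 0`, where `Sprung2012.colemanKer … c .flat` is every functional) the ♭-line `L^E_J` is trivial, the transported dual `𝓑'^*` is relaxed at
`v` and contains the Mordell–Weil classes of `W₂` at every level, and the count fails; for Honda data the bound is the LINE hand's target.
Everything else is the W₂-side count `natCard_selmerGroup_mul_eq_of_line` (file 4/5) with `B = #T` (`#H¹_𝓑 = #T[2^J]`, ★ p813776
`OddBlindLocal.natCard_torsionBy_endInvariants_eq_natCard_selmerGroup_transport` on HT-C1 ★ p812879), `#L_J = #L^E_J` (`ψ` injective) and
`W₂(ℚ_v)[2] = 0` (★ p814209 `OddBlindLocal.forall_two_nsmul_eq_zero_adicCompletion_twist_of_goodSS`).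

References: [GreenbergLNM1716] §3 Lemma 3.3, §4 pp. 105–107, 122–124; [MilneADT2006] I Thm. 4.10, Ex. 1.6 (c), Thm. 2.13, Lemma 3.3;
[Howard2004HeegnerKolyvagin] Thm. 2.1.11; [Sprung2012] Def. 7.9/7.11; [Sakamoto2024] §3.1.2.
-/

set_option autoImplicit false
set_option linter.dupNamespace false

noncomputable section

open scoped Classical NumberField AddSubgroup ContRepresentation

namespace Summit.BirchSwinnertonDyer.BirchSwinnertonDyer.Theorems

namespace FlatBlindTamagawaSplitting

open NumberField IsDedekindDomain Field Function WeierstrassCurve Literature.NumberTheory.EllipticCurves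
  Literature.NumberTheory.GaloisRepresentations Literature.NumberTheory.GaloisCohomology
open Literature.NumberTheory.GaloisRepresentations.DiscreteGaloisModule (SelmerStructure)
open Summit.BirchSwinnertonDyer.Rank1Residual.X11b Summit.BirchSwinnertonDyer.Rank1Residual.X11b.KummerPT
  Summit.BirchSwinnertonDyer.Rank1Residual.X11b.LocBridge Summit.BirchSwinnertonDyer.Rank1Residual.X5


open Literature.NumberTheory.EllipticCurves.IwasawaDual ZpExtension Literature.NumberTheory.EllipticCurves.Kobayashi2003
  Literature.NumberTheory.EllipticCurves.Sprung2017 Literature.NumberTheory.EllipticCurves.Sprung2012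
  Literature.NumberTheory.EllipticCurves.Rank1Residual Summit.BirchSwinnertonDyer.Rank1Residual.Additive

/-- **HT-C6 = h8 = B2 (THE TAMAGAWA SPLITTING COUNT at a large finite level), CORRECTED SIGNATURE, modulo the print binder
`hPT`.** The LEAD's binder `hB2` of ★★ p814705 `OddBlindLocal.flatBlindControlCardHondaAtTwo_of` VERBATIM, except for ONE inner
hypothesis inserted after `κ.IsTopGenerator (resGalOfEmb …) g →`: the ♭-LINE LOWER BOUND `∃ J₃, ∀ J ≥ J₃, 2^J ≤ #L^E_J` at the
distinguished place `v ∣ 2` (conjunct (C) of the LEAD's hand hE, tree `…FlatBlindCardPositionLocal.lean` :136–139; FALSE for degenerate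
Sprung data `c`, e.g. `c = 0`, where `colemanKer … c .flat` is everything and `L^E_J = 0` — which is why hB2 as typed is not provable).
For `W/ℚ` globally minimal with `GoodSS W 2`, `κ` cyclotomic with generator `γ`, `v ∋ 2`, local data `(g, c)` with the line bound, `W₂` a
globally minimal model of the twist by `2`, `T = Sel♭(E/ℚ_∞)[γ+1]` finite: for `J ≥ J₁`, any mutually inverse intertwiners `φ, ψ` with the
dictionary clauses (ii)(iii)(iv), and the Selmer structures `𝓑` (transported exact structure: Kummer at `∞` by (ii), tower kernels
`𝓚_J(ℓ)` at `ℓ ≠ v` by (iii), the transported ♭-line `L_J` at `v`) and `𝓑'` (Kummer at `∞` and at `ℓ ≠ v`, `L_J` at `v`):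
**`#H¹_𝓑 · 2^{v₂ c₂(W₂ ⊗ ℚ_v)} = #H¹_{𝓑'} · 2^{v₂ Tam(W₂)}`.**  PROOF: `natCard_selmerGroup_mul_eq_of_line` (the W₂-side count:
Poitou–Tate counting form `natCard_selmerQuotient_mul_of_poitouTate` for `𝓑' ≤ 𝓑`; local factors `[𝓚_J(ℓ) : Kum_J(ℓ)] = #ker(res_tower) =
2^{v₂ c_ℓ(W₂)}` by HT-C3 ★★ p814192; trivial dual correction by Sakamoto's Weil transport, Kummer self-duality at every place incl. the
real one (`hPT`'s fifth conjunct), the one-place count, the line bound, level lowering and HT-C4(c) ★ p814002) with `B = #T`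
(`#H¹_𝓑 = #T[2^J] ≤ #T`, ★ p813776 transport + HT-C1 ★ p812879), `#L_J = #L^E_J` (`ψ` injective), `W₂(ℚ_v)[2] = 0` (★ p814209).
`--supports stmt-BirchSwinnertonDyer-19097 --as helper`; typed ≠ proved: the crux, CDC_H and BSD are NOT proved by this.
[cite: GreenbergLNM1716, §3 Lemma 3.3 and §4 pp. 122–124] [cite: MilneADT2006, Ch. I, Thm. 4.10, Cor. 2.3, Thm. 2.13, Lemma 3.3]
[cite: Howard2004HeegnerKolyvagin, Thm. 2.1.11 (arXiv:1202.6340 p. 6)] [cite: Sakamoto2024, §3.1.2 (p. 924)] -/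
theorem HTC6_tamagawa_of_lineCard (hPT : Literature.NumberTheory.GaloisCohomology.poitouTate_selmerStructure_duality_real ℚ) :
    ∀ (W : WeierstrassCurve ℚ) [W.IsElliptic] [W.IsGloballyMinimal], GoodSS W 2 →
      ∀ (κ : ZpExtension ℚ 2) (γ : Field.absoluteGaloisGroup ℚ), κ.IsCyclotomic → κ.IsTopGenerator γ →
      ∀ (v : HeightOneSpectrum (𝓞 ℚ)), (2 : 𝓞 ℚ) ∈ v.asIdeal →
      ∀ (g : Field.absoluteGaloisGroup (v.adicCompletion ℚ)) (c : ℕ → localPoints W (v.adicCompletion ℚ)),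
        κ.IsTopGenerator (resGalOfEmb (closureEmb (K := ℚ) (v.adicCompletion ℚ)) g) →
        (∃ J₃ : ℕ, ∀ J : ℕ, J₃ ≤ J →
          2 ^ J ≤ Nat.card (W.twistedSharpFlatLocalFamily 2 κ J (-1) OddBlindTwist.two_dvd_neg_one_sub_one v
            (localTowerPointsOfEmb κ (closureEmb (K := ℚ) (v.adicCompletion ℚ)) W)
            (colemanKer κ (closureEmb (K := ℚ) (v.adicCompletion ℚ)) W (W.frobeniusTrace 2) g c .flat) v)) →
      ∀ (W₂ : WeierstrassCurve ℚ) [W₂.IsElliptic] [W₂.IsGloballyMinimal],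
        (∃ C : WeierstrassCurve.VariableChange ℚ, C • W.quadraticTwist 2 = W₂) →
        Finite (endInvariants (conjSharpFlatSelmerInfty W κ (closureEmb (K := ℚ) (v.adicCompletion ℚ))
          (W.frobeniusTrace 2) g c .flat γ + 1)) →
      ∃ J₁ : ℕ, ∀ J : ℕ, J₁ ≤ J →
      ∀ (φ : (W₂.torsionGaloisModule ((2 ^ J : ℕ) : ℤ)).toContRepresentation →ⁱL
          (W.twistedTorsionGaloisModule 2 κ J (-1) OddBlindTwist.two_dvd_neg_one_sub_one).toContRepresentation)
        (ψ : (W.twistedTorsionGaloisModule 2 κ J (-1) OddBlindTwist.two_dvd_neg_one_sub_one).toContRepresentation →ⁱL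
          (W₂.torsionGaloisModule ((2 ^ J : ℕ) : ℤ)).toContRepresentation),
        (∀ a, ψ (φ a) = a) → (∀ b, φ (ψ b) = b) →
        (∀ w : InfinitePlace ℚ, ((W.twistedTorsionToLocalH1 2 κ J (-1) OddBlindTwist.two_dvd_neg_one_sub_one w.Completion).ker).map
            (galoisCohomology.map (ψ.restrictField w.Completion) 1) =
          W₂.kummerLocalConditionAt ((2 ^ J : ℕ) : ℤ) w.Completion) →
        (∀ v' : HeightOneSpectrum (𝓞 ℚ), v' ≠ v →
          (W.twistedSharpFlatLocalFamily 2 κ J (-1) OddBlindTwist.two_dvd_neg_one_sub_one v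
              (localTowerPointsOfEmb κ (closureEmb (K := ℚ) (v.adicCompletion ℚ)) W)
              (colemanKer κ (closureEmb (K := ℚ) (v.adicCompletion ℚ)) W (W.frobeniusTrace 2) g c .flat) v').map
            (galoisCohomology.map (ψ.restrictField (v'.adicCompletion ℚ)) 1) =
          ((resH1Hom (Literature.NumberTheory.EllipticCurves.subgroupIncl (localSubgroup κ.kerSubgroup (v'.adicCompletion ℚ)))
              (AddMonoidHom.id (localPoints W₂ (v'.adicCompletion ℚ))) (fun _ _ ↦ rfl)).ker).comap
            (galoisCohomology.map (W₂.torsionPointsMapIntertwining ((2 ^ J : ℕ) : ℤ) (v'.adicCompletion ℚ)) 1)) →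
        (W₂.kummerLocalConditionAt ((2 ^ J : ℕ) : ℤ) (v.adicCompletion ℚ)).map
            (galoisCohomology.map (φ.restrictField (v.adicCompletion ℚ)) 1) ≤
          W.twistedTorsionLocalKummer 2 κ J (-1) OddBlindTwist.two_dvd_neg_one_sub_one (v.adicCompletion ℚ)
            (localLayerPointsOfEmb κ (closureEmb (K := ℚ) (v.adicCompletion ℚ)) W 1 ⊓
              (DistribSMul.toAddMonoidHom (localPoints W (v.adicCompletion ℚ)) g + AddMonoidHom.id _).ker) →
      ∀ (𝓑 𝓑' : SelmerStructure (W₂.torsionGaloisModule ((2 ^ J : ℕ) : ℤ))),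
        (∀ w : InfinitePlace ℚ, 𝓑 (Sum.inl w) =
          ((W.twistedTorsionToLocalH1 2 κ J (-1) OddBlindTwist.two_dvd_neg_one_sub_one w.Completion).ker).map
            (galoisCohomology.map (ψ.restrictField w.Completion) 1)) →
        (∀ v' : HeightOneSpectrum (𝓞 ℚ), 𝓑 (Sum.inr v') =
          (W.twistedSharpFlatLocalFamily 2 κ J (-1) OddBlindTwist.two_dvd_neg_one_sub_one v
            (localTowerPointsOfEmb κ (closureEmb (K := ℚ) (v.adicCompletion ℚ)) W)
            (colemanKer κ (closureEmb (K := ℚ) (v.adicCompletion ℚ)) W (W.frobeniusTrace 2) g c .flat) v').map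
            (galoisCohomology.map (ψ.restrictField (v'.adicCompletion ℚ)) 1)) →
        (∀ w : InfinitePlace ℚ, 𝓑' (Sum.inl w) = W₂.kummerLocalConditionAt ((2 ^ J : ℕ) : ℤ) w.Completion) →
        (𝓑' (Sum.inr v) = (W.twistedSharpFlatLocalFamily 2 κ J (-1) OddBlindTwist.two_dvd_neg_one_sub_one v
            (localTowerPointsOfEmb κ (closureEmb (K := ℚ) (v.adicCompletion ℚ)) W)
            (colemanKer κ (closureEmb (K := ℚ) (v.adicCompletion ℚ)) W (W.frobeniusTrace 2) g c .flat) v).map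
            (galoisCohomology.map (ψ.restrictField (v.adicCompletion ℚ)) 1)) →
        (∀ v' : HeightOneSpectrum (𝓞 ℚ), v' ≠ v → 𝓑' (Sum.inr v') = W₂.kummerLocalConditionAt ((2 ^ J : ℕ) : ℤ) (v'.adicCompletion ℚ)) →
        Nat.card 𝓑.selmerGroup *
            2 ^ padicValNat 2 ((W₂.baseChange (v.adicCompletion ℚ)).localTamagawaNumber (v.adicCompletionIntegers ℚ)) =
          Nat.card 𝓑'.selmerGroup * 2 ^ padicValNat 2 W₂.tamagawaProduct := by
  intro W _ _ hss κ γ hκ hγ v hv g c hg hLC W₂ _ _ htw hT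
  haveI := hT
  have h0v := OddBlindLocal.forall_two_nsmul_eq_zero_adicCompletion_twist_of_goodSS W hss W₂ htw v hv
  obtain ⟨J₃, hJ₃⟩ := hLC
  obtain ⟨J₁, hJ₁⟩ := natCard_selmerGroup_mul_eq_of_line hPT W₂ hκ v hv h0v
    (Nat.card (endInvariants (conjSharpFlatSelmerInfty W κ (closureEmb (K := ℚ) (v.adicCompletion ℚ))
      (W.frobeniusTrace 2) g c .flat γ + 1)))
  refine ⟨max J₁ J₃, fun J hJ φ ψ h₁ h₂ hinf hne hiv 𝓑 𝓑' h𝓑inl h𝓑inr h𝓑'inl h𝓑'v h𝓑'ne ↦ ?_⟩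
  -- the transported line has the cardinality of the E-side line (`ψ` is injective)
  have hΨinj : Function.Injective (galoisCohomology.map (ψ.restrictField (v.adicCompletion ℚ)) 1) :=
    CongruentTransfer.map_restrictField_injective_of_comp_eq ψ φ h₂ (Sum.inr v)
  have hL : 2 ^ J ≤ Nat.card (𝓑' (Sum.inr v)) := by
    rw [h𝓑'v]
    exact (hJ₃ J (le_of_max_le_right hJ)).trans_eq (Nat.card_congr (AddSubgroup.equivMapOfInjective _ _ hΨinj).toEquiv)
  -- `#H¹_𝓑 = #T[2^J] ≤ #T`
  have hB : Nat.card 𝓑.selmerGroup ≤ Nat.card (endInvariants (conjSharpFlatSelmerInfty W κ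
      (closureEmb (K := ℚ) (v.adicCompletion ℚ)) (W.frobeniusTrace 2) g c .flat γ + 1)) := by
    rw [← OddBlindLocal.natCard_torsionBy_endInvariants_eq_natCard_selmerGroup_transport W hss hκ hγ v hv g c J W₂ φ ψ h₁ h₂ 𝓑
      h𝓑inl h𝓑inr]
    exact AddSubgroup.card_le_card_addGroup _
  exact hJ₁ J (le_of_max_le_left hJ) (𝓑' (Sum.inr v)) hL 𝓑 𝓑' (fun w ↦ by rw [h𝓑inl w, hinf w])
    (by rw [h𝓑inr v, h𝓑'v]) (fun v' hv' ↦ by rw [h𝓑inr v', hne v' hv']) h𝓑'inl rfl h𝓑'ne hB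


end FlatBlindTamagawaSplitting

end Summit.BirchSwinnertonDyer.BirchSwinnertonDyer.Theorems

end
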